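import Mathlib
import HarnessLib
import Summits.ResolutionOfSingularities.ResolutionOfSingularities.Theorems.WildQuotientsWildQuotientResolutionJordanFourChartWDefs
import Summits.ResolutionOfSingularities.ResolutionOfSingularities.Theorems.WildQuotientsWildQuotientResolutionJordanFourTwistedChartInvariants
import Summits.ResolutionOfSingularities.ResolutionOfSingularities.Theorems.WildQuotientsWildQuotientResolutionJordanFourI6StableJ4
import Summits.ResolutionOfSingularities.ResolutionOfSingularities.Theorems.WildQuotientsWildQuotientResolutionToricExitProjMap

/-!
# V4U brick `HWst`: the twisted root chart `W_T = D₊(T′t · H′³t²)` of `Bl_{I₆} 𝔸ⁿ` is `⟨σ⟩`-stable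
(crux stmt-ResolutionOfSingularities-15640 `WildQuotients.WildQuotientResolution`, line `Sketch`;
chain w45c programme V4U, CHAIN v7.3 §4 row stub-5 (RULING v7.1 ★HWst), brick `HWst` of
res-L1-w45c-lead-1's `JordanFour.jordanFour_hasResolution_of_bricks` (p501160) for the W term of
record `JordanFour.chartW`; written by res-D-pv-033 AS res-L1-w45c-stub-5; [OURS · L1 W4.5c] —
NOT a statement of any manuscript.)

* `JordanFour.smul_tPrime`, `JordanFour.smul_hPrime`, `JordanFour.smul_tPrime_mul_hPrime_cube` —
  every `g ∈ ⟨σ⟩` fixes `T′`, `H′` and `T′ H′³` (stub-1's `map_tPrime`/`map_hPrime`, p500124, and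
  `MulAction.fixedBy_subset_fixedBy_zpow`);
* `JordanFour.preimage_chartW_eq` — **`(ρV g)⁻¹ chartW = chartW`** for the lifted action
  `ρV = (affineBlowup.isBlowup I₆).liftAction ρ (idealSheaf_I6_comap …)` of ANY `ρ` with the
  affine-quotient law: the lifted action is `Proj.map` of the coefficientwise Rees automorphism
  (`ToricExit.preimage_basicOpen_liftAction_of_monomial`, …ToricExitProjMap) and the section
  `T′t · H′³t² = (T′H′³) t³` has invariant coefficient. VERBATIM the binder `HWst` of p501160 with
  `W := chartW k n a b c d`.
-/

-- single-problem summit: the doubled namespace component `ResolutionOfSingularities` is forced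
set_option linter.dupNamespace false

noncomputable section

open CategoryTheory AlgebraicGeometry TopologicalSpace MvPolynomial Polynomial
open Literature.AlgebraicGeometry.Resolution
open scoped Pointwise

namespace Summit.ResolutionOfSingularities.ResolutionOfSingularities.Theorems.WildQuotientResolution.JordanFour

variable (k : Type) [Field k] (n : ℕ) (σ : MvPolynomial (Fin n) k ≃ₐ[k] MvPolynomial (Fin n) k)
  (a b c d : Fin n) (hab : a ≠ b) (hac : a ≠ c) (had : a ≠ d)
  (hb : σ (X b) = X b + X a) (hc : σ (X c) = X c + X b) (hd : σ (X d) = X d + X c)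
  (hσ : ∀ i, i ≠ b → i ≠ c → i ≠ d → σ (X i) = X i)

include hab hac had hb hc hd hσ in
/-- **Every `g ∈ ⟨σ⟩` fixes `T′`.** [OURS · L1 W4.5c] -/
theorem smul_tPrime (g : ↥(Subgroup.zpowers σ)) :
    g • tPrime k n a b c d = tPrime k n a b c d := by
  have hσ' : σ • tPrime k n a b c d = tPrime k n a b c d :=
    map_tPrime k n a b c d hab hac had (σ : MvPolynomial (Fin n) k →ₐ[k] MvPolynomial (Fin n) k)
      hb hc hd hσ
  obtain ⟨z, hz⟩ := Subgroup.mem_zpowers_iff.mp g.2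
  change (g : MvPolynomial (Fin n) k ≃ₐ[k] MvPolynomial (Fin n) k) • tPrime k n a b c d = _
  rw [← hz]
  exact MulAction.fixedBy_subset_fixedBy_zpow (MvPolynomial (Fin n) k) σ z hσ'

include hab hac had hb hc hσ in
/-- **Every `g ∈ ⟨σ⟩` fixes `H′`.** [OURS · L1 W4.5c] -/
theorem smul_hPrime (g : ↥(Subgroup.zpowers σ)) :
    g • hPrime k n a b c = hPrime k n a b c := by
  have hσ' : σ • hPrime k n a b c = hPrime k n a b c :=
    map_hPrime k n a b c d hab hac had (σ : MvPolynomial (Fin n) k →ₐ[k] MvPolynomial (Fin n) k)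
      hb hc hσ
  obtain ⟨z, hz⟩ := Subgroup.mem_zpowers_iff.mp g.2
  change (g : MvPolynomial (Fin n) k ≃ₐ[k] MvPolynomial (Fin n) k) • hPrime k n a b c = _
  rw [← hz]
  exact MulAction.fixedBy_subset_fixedBy_zpow (MvPolynomial (Fin n) k) σ z hσ'

include hab hac had hb hc hd hσ in
/-- **Every `g ∈ ⟨σ⟩` fixes `T′ H′³`** (the coefficient of the section `T′t · H′³t²`). [OURS · L1 W4.5c] -/
theorem smul_tPrime_mul_hPrime_cube (g : ↥(Subgroup.zpowers σ)) :
    g • (tPrime k n a b c d * hPrime k n a b c ^ 3) = tPrime k n a b c d * hPrime k n a b c ^ 3 := by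
  rw [smul_mul', smul_pow', smul_tPrime k n σ a b c d hab hac had hb hc hd hσ g,
    smul_hPrime k n σ a b c d hab hac had hb hc hσ g]

include hd in
/-- **Brick `HWst` of the J₄ toric exit**: the twisted root chart `chartW = D₊(T′t · H′³t²)` is
stable under the lifted action of every `g ∈ ⟨σ⟩` on `Bl_{I₆} 𝔸ⁿ` (for ANY `ρ` with the
affine-quotient law `ρ g = Spec (g⁻¹ • ·)`). VERBATIM the binder `HWst` of
`JordanFour.jordanFour_hasResolution_of_bricks` (p501160) at `W := chartW k n a b c d`.
[OURS · L1 W4.5c] [folklore; assembly of landed decls] -/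
theorem preimage_chartW_eq
    (ρ : ↥(Subgroup.zpowers σ) →* Aut (Spec (CommRingCat.of (MvPolynomial (Fin n) k))))
    (hρ : ∀ g : ↥(Subgroup.zpowers σ), (ρ g).hom = Spec.map (CommRingCat.ofHom
      ((MulSemiringAction.toRingEquiv (↥(Subgroup.zpowers σ)) (MvPolynomial (Fin n) k) g⁻¹ :
        MvPolynomial (Fin n) k ≃+* MvPolynomial (Fin n) k) :
          MvPolynomial (Fin n) k →+* MvPolynomial (Fin n) k)))
    (g : ↥(Subgroup.zpowers σ)) :
    (((affineBlowup.isBlowup (Ideal.span (Set.range (![X a ^ 2, X a * X b ^ 2, X a * X b * X c,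
        X a * X c ^ 3, X b ^ 3, X b ^ 2 * X c ^ 2, X b * X c ^ 4, X c ^ 6] :
          Fin 8 → MvPolynomial (Fin n) k)))).liftAction ρ
        (idealSheaf_I6_comap k n σ a b c (hσ a hab hac had) hb hc ρ hρ)) g).hom ⁻¹ᵁ
      chartW k n a b c d = chartW k n a b c d :=
  ToricExit.preimage_basicOpen_liftAction_of_monomial ρ hρ
    (idealSheaf_I6_comap k n σ a b c (hσ a hab hac had) hb hc ρ hρ) g
    (smul_I6_eq k n σ a b c (hσ a hab hac had) hb hc) _ (coe_chartW_section k n a b c d)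
    (smul_tPrime_mul_hPrime_cube k n σ a b c d hab hac had hb hc hd hσ)

end Summit.ResolutionOfSingularities.ResolutionOfSingularities.Theorems.WildQuotientResolution.JordanFour

end
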